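import Mathlib
import Summits.Ventures.HodgeRepro2.T5TwoZeroPositivity
import Summits.Ventures.HodgeRepro2.BergmanIntegral
import Summits.Ventures.HodgeRepro2.PeterssonCompactQuotient

/-!
# HodgePeterssonBridge — the Hodge pairing of (2,0)-forms on the ball quotient is `4 ×` the
weight-3 Petersson product

Blind cell `pub-hodge-repro2`, seat p2 (Tier 5, sub-step N1 = IDENTIFICATION, §ID-4(b′)).

Two kernel models of the period `∫_S ω_f ∧ \overline{ω_g}` of Lemma A7.1 / Theorem ID(iv) exist in
this cell:

* p6's six-coefficient model `T5HodgeStar` of the complex 2-covectors at a point of a complex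
  surface (`twoZero b = b • dz₁∧dz₂`, `conjC`, `wedge γ δ` = the coefficient of the volume form in
  `γ ∧ δ`), with `T5TwoZeroPositivity.integral_wedge`:
  `∫_S wedge (twoZero (a s)) (conjC (twoZero (b s))) dμ = 4 ∫_S a · conj b dμ` for ANY measure `μ`;
* this seat's Petersson product of weight-`k` functions on the ball `𝔹²` against the Bergman
  measure (`peterssonPair`, `peterssonInner`, `quotientMeasure`), with `BergmanIntegral.setIntegral_peterssonPair_three`:
  `∫_D f · conj g · (1 − ‖z‖²)³ dμ_B = ∫_{val '' D} f · conj g dLeb`.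

This file glues the two: the coefficient-model period of the (2,0)-forms `ω_f = f dz₁∧dz₂`,
`ω_g = g dz₁∧dz₂` over a fundamental domain `D ⊂ 𝔹²` (integrated against Lebesgue measure on the
ball coordinates — the complex orientation of Lemma A7.1) equals `4 ×` the weight-3 Petersson
product `⟨f, g⟩` on `S = Γ\𝔹²`; hence, on a compact quotient, the period pairing is positive
definite and `(N)` for `ω_g = c · ω_f` holds iff `c ≠ 0` and `f ≢ 0` on the ball (Lemma A7.1's
«in particular»).

What stays prose: the passage from the differential form on the complex manifold `S` to its
coefficient in the ball coordinates (the bundle-versus-trivialisation bookkeeping; p6's memo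
route/T5-N1-hodge-p6.md) and the identification of the Lebesgue integral over a fundamental domain
with the integral of a top form over `S` (Voisin (5.1) as the definition of the L²-product).
-/

namespace Summit.Ventures.HodgeRepro2.ShimuraData

open MeasureTheory
open scoped ComplexConjugate

/-- The coefficient-model period density of two (2,0)-forms `ω_f = f dz₁∧dz₂`, `ω_g = g dz₁∧dz₂`
on `ℂ²`: the coefficient of the volume form in `ω_f ∧ \overline{ω_g}` at the point `z`, in p6's
six-coefficient model `T5HodgeStar`. -/
noncomputable def hodgeWedge (f g : (Fin 2 → ℂ) → ℂ) (z : Fin 2 → ℂ) : ℂ :=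
  T5HodgeStar.wedge (T5HodgeStar.twoZero (f z)) (T5HodgeStar.conjC (T5HodgeStar.twoZero (g z)))

/-- Pointwise: `ω_f ∧ \overline{ω_g} = 4 · f · conj g · Vol` (Lemma A7.1's computation
`dz₁∧dz₂∧dz̄₁∧dz̄₂ = 4 dx₁∧dy₁∧dx₂∧dy₂`, read off from p6's model). -/
theorem hodgeWedge_eq (f g : (Fin 2 → ℂ) → ℂ) (z : Fin 2 → ℂ) :
    hodgeWedge f g z = 4 * f z * conj (g z) :=
  T5TwoZeroPositivity.wedge_twoZero_conjC _ _

/-- The period density is sesquilinear in the second slot: `ω_f ∧ \overline{c · ω_g}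
= conj c · (ω_f ∧ \overline{ω_g})`. -/
theorem hodgeWedge_smul_right (f g : (Fin 2 → ℂ) → ℂ) (c : ℂ) (z : Fin 2 → ℂ) :
    hodgeWedge f (c • g) z = conj c * hodgeWedge f g z := by
  simp only [hodgeWedge_eq, Pi.smul_apply, smul_eq_mul, map_mul]
  ring

/-- The period density of a form against itself is the real number `4 ‖f z‖²`. -/
theorem hodgeWedge_self (f : (Fin 2 → ℂ) → ℂ) (z : Fin 2 → ℂ) :
    hodgeWedge f f z = ((4 * ‖f z‖ ^ 2 : ℝ) : ℂ) :=
  T5TwoZeroPositivity.wedge_twoZero_conjC_self _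

/-- On the ball, the period density is `4 ×` the weight-3 polarised Petersson density divided by
the Bergman volume density: `hodgeWedge f g z · (1 − ‖z‖²)³ = 4 · peterssonPair 3 f g z`. -/
theorem hodgeWedge_mul_eq_peterssonPair (f g : (Fin 2 → ℂ) → ℂ) (z : Fin 2 → ℂ) :
    hodgeWedge f g z * ((1 - normSq₂ z) ^ 3 : ℝ) = 4 * peterssonPair 3 f g z := by
  simp only [hodgeWedge_eq, peterssonPair]
  ring

/-- **The bridge (set-integral form).** For coefficient functions `f g` and a measurable
`D ⊂ 𝔹²`, the coefficient-model period over `D` (Lebesgue measure in the ball coordinates =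
the complex orientation) is `4 ×` the weight-3 Petersson pairing of `f` and `g` over `D` against
the Bergman measure. -/
theorem setIntegral_hodgeWedge (f g : (Fin 2 → ℂ) → ℂ) {D : Set ball₂} (hD : MeasurableSet D) :
    ∫ x in Subtype.val '' D, hodgeWedge f g x
      = 4 * ∫ z in D, peterssonPair 3 f g (z : Fin 2 → ℂ) ∂bergmanBall := by
  rw [setIntegral_peterssonPair_three f g hD]
  exact T5TwoZeroPositivity.integral_wedge (μ := volume.restrict (Subtype.val '' D)) f g

/-- The period against itself over `D` is the real number `4 ∫_D ‖f‖² (1 − ‖z‖²)³ dμ_B`, i.e.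
`4 ×` the Petersson norm. -/
theorem setIntegral_hodgeWedge_self (f : (Fin 2 → ℂ) → ℂ) {D : Set ball₂} (hD : MeasurableSet D) :
    ∫ x in Subtype.val '' D, hodgeWedge f f x
      = ((4 * ∫ z in D, petersson 3 f (z : Fin 2 → ℂ) ∂bergmanBall : ℝ) : ℂ) := by
  rw [setIntegral_hodgeWedge f f hD]
  simp only [peterssonPair_self, integral_complex_ofReal, Complex.ofReal_mul, Complex.ofReal_ofNat]

section quotient

variable {K : Type*} [Field K] [NumberField K] [NumberField.IsCMField K] {τ₁ : K →+* ℂ}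
  {H : Matrix (Fin 3) (Fin 3) K} {Q : Matrix (Fin 3) (Fin 3) ℂ} (hQ : IsFrame K τ₁ H Q)
  (S : Subgroup (GL (Fin 3) K)) (hS : (S : Set (GL (Fin 3) K)) ⊆ unitaryGroup K H)

/-- **The bridge (Petersson form).** For weight-3 functions `f g` for `S`, continuous on the
ball, and a measurable `D ⊂ 𝔹²`, the coefficient-model period over `D` equals `4 ×` the
Petersson inner product on `S\𝔹²` against the quotient measure carried by `D`. -/
theorem setIntegral_hodgeWedge_eq_peterssonInner {D : Set ball₂} (hD : MeasurableSet D)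
    {f g : (Fin 2 → ℂ) → ℂ} (hf : IsWeightFor τ₁ Q S 3 f) (hg : IsWeightFor τ₁ Q S 3 g)
    (hfc : ContinuousOn f ball₂) (hgc : ContinuousOn g ball₂) :
    ∫ x in Subtype.val '' D, hodgeWedge f g x
      = 4 * peterssonInner hQ S hS (quotientMeasure hQ S hS D) hf hg := by
  rw [setIntegral_hodgeWedge f g hD, peterssonInner_quotientMeasure hQ S hS D hf hg hfc hgc]

/-- The period over a measurable fundamental domain does not depend on the fundamental domain
(for weight-3 functions for `S`). -/
theorem setIntegral_hodgeWedge_eq_of_isBallFundamentalDomain {D D' : Set ball₂}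
    (hD : IsBallFundamentalDomain hQ S hS D) (hD' : IsBallFundamentalDomain hQ S hS D')
    (hDm : MeasurableSet D) (hD'm : MeasurableSet D')
    {f g : (Fin 2 → ℂ) → ℂ} (hf : IsWeightFor τ₁ Q S 3 f) (hg : IsWeightFor τ₁ Q S 3 g) :
    ∫ x in Subtype.val '' D, hodgeWedge f g x = ∫ x in Subtype.val '' D', hodgeWedge f g x := by
  rw [setIntegral_hodgeWedge f g hDm, setIntegral_hodgeWedge f g hD'm,
    setIntegral_peterssonPair_eq hQ S hS hD hD' hf hg]

/-- **`(N)` ⟺ Petersson ≠ 0**: the coefficient-model period of `ω_f` against `ω_g` over a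
measurable `D` is non-zero iff the Petersson inner product of `f` and `g` on `S\𝔹²` (quotient
measure carried by `D`) is non-zero. -/
theorem setIntegral_hodgeWedge_ne_zero_iff {D : Set ball₂} (hD : MeasurableSet D)
    {f g : (Fin 2 → ℂ) → ℂ} (hf : IsWeightFor τ₁ Q S 3 f) (hg : IsWeightFor τ₁ Q S 3 g)
    (hfc : ContinuousOn f ball₂) (hgc : ContinuousOn g ball₂) :
    ∫ x in Subtype.val '' D, hodgeWedge f g x ≠ 0
      ↔ peterssonInner hQ S hS (quotientMeasure hQ S hS D) hf hg ≠ 0 := by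
  rw [setIntegral_hodgeWedge_eq_peterssonInner hQ S hS hD hf hg hfc hgc, mul_ne_zero_iff]
  simp

variable [CompactSpace (ballQuotient hQ S hS)]

/-- **Positivity of the period pairing** (Lemma A7.1: «(·,·) is positive definite»): on a
compact quotient `S\𝔹²`, for a continuous weight-3 `f` not vanishing at some point of the ball
and a measurable fundamental domain `D`, the period `∫_D ω_f ∧ \overline{ω_f}` has positive real
part. -/
theorem setIntegral_hodgeWedge_self_re_pos {D : Set ball₂} (hD : IsBallFundamentalDomain hQ S hS D)
    (hDm : MeasurableSet D) {f : (Fin 2 → ℂ) → ℂ} (hf : IsWeightFor τ₁ Q S 3 f)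
    (hfc : ContinuousOn f ball₂) {z₀ : Fin 2 → ℂ} (hz₀ : z₀ ∈ ball₂) (h0 : f z₀ ≠ 0) :
    0 < (∫ x in Subtype.val '' D, hodgeWedge f f x).re := by
  rw [setIntegral_hodgeWedge_self f hDm, Complex.ofReal_re]
  have := setIntegral_petersson_pos hQ S hS hD hf hfc hz₀ h0
  linarith

/-- The period of a form against itself vanishes iff the form vanishes on the ball. -/
theorem setIntegral_hodgeWedge_self_eq_zero_iff {D : Set ball₂}
    (hD : IsBallFundamentalDomain hQ S hS D) (hDm : MeasurableSet D) {f : (Fin 2 → ℂ) → ℂ}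
    (hf : IsWeightFor τ₁ Q S 3 f) (hfc : ContinuousOn f ball₂) :
    ∫ x in Subtype.val '' D, hodgeWedge f f x = 0 ↔ ∀ z ∈ ball₂, f z = 0 := by
  rw [setIntegral_hodgeWedge_self f hDm,
    ← setIntegral_petersson_eq_zero_iff_of_compactSpace hQ S hS hD hf hfc, Complex.ofReal_eq_zero,
    mul_eq_zero]
  simp

/-- **Lemma A7.1, «in particular»**: if `ω_g = c · ω_f` then `(N)` — the period
`∫ ω_f ∧ \overline{ω_g} ≠ 0` — holds iff `c ≠ 0` and `f` does not vanish identically on the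
ball. -/
theorem setIntegral_hodgeWedge_smul_ne_zero_iff {D : Set ball₂}
    (hD : IsBallFundamentalDomain hQ S hS D) (hDm : MeasurableSet D) {f : (Fin 2 → ℂ) → ℂ}
    (hf : IsWeightFor τ₁ Q S 3 f) (hfc : ContinuousOn f ball₂) (c : ℂ) :
    ∫ x in Subtype.val '' D, hodgeWedge f (c • f) x ≠ 0 ↔ c ≠ 0 ∧ ∃ z ∈ ball₂, f z ≠ 0 := by
  have hsmul : ∫ x in Subtype.val '' D, hodgeWedge f (c • f) x
      = conj c * ∫ x in Subtype.val '' D, hodgeWedge f f x := by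
    rw [← integral_const_mul]
    exact integral_congr_ae (Filter.Eventually.of_forall fun x => hodgeWedge_smul_right f f c x)
  rw [hsmul, mul_ne_zero_iff, ne_eq, ne_eq, map_eq_zero,
    setIntegral_hodgeWedge_self_eq_zero_iff hQ S hS hD hDm hf hfc]
  simp only [ne_eq, not_forall, exists_prop]

end quotient

end Summit.Ventures.HodgeRepro2.ShimuraData
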